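import Summits.QuantumFields.YangMills.Theorems.BalabanUVNodesK0Stub1SectFWSlotAtRecordFlatScaledHerm0
import Summits.QuantumFields.YangMills.Theorems.BalabanUVNodesK0Stub1FlatMultiplierScaledO1Letter
import Summits.QuantumFields.YangMills.Theorems.BalabanUVNodesK0Stub1FibreTraceLetters
import HarnessLib

/-!
# K0⁷ STUB 1 (`stub_prop8StepCoP13` ∕ V20-G `stub_prop8StepCoPG13`), sub-target S4b «the (δ∕δA′)V pieces at objects» — **D‴ ∕ A6: SECT. F's CURRENT `W` AT INSTANCE (S)
# EXISTS AT EVERY ADMISSIBLE FAMILY OF THE RECORD's FOUR-TORI, WITH THE (98)-SLOT AND WITH THE REALITY OF THE IMPLICIT ♭ CHART DISPLAYED — NO LETTER HYPOTHESIS**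
# (this seat's D″ `…SectFWSlotAtRecordFlatScaledExists` (p636369, `exists_sectF_W_flatScaled_atRecord`) RE-THREADED over C‴ `…SectFWSlotAtRecordFlatScaledHerm0`:
# the statement is D″'s VERBATIM plus ONE conjunct «for every Hermitian-traceless `A′` in the `ε`-ball, `Dsel A′` and `A′ − H(Dsel A′)` are Hermitian-traceless»)

Cell `pub-ymgap`, width seat `pub-ymgap-k0-s1-w2` g6 (CLAIM-2, bus 2026-08-28 ≈14:00Z).  `--kind proof --supports stmt-QuantumFields-20541 --as helper`; count-neutral;
def-free.  [15] = [Balaban1985Variational]; [B7] = [Balaban1985Averaging]; [B6] = [Balaban1984PropagatorsII].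

WHY.  The objects of D″ feed (i) the ♭ (127) junction (this seat's `…K0Stub1Eq157FlatScaledS1` §3: the charted curve `e^{iη(A′ − H♭Dsel♭A′)}` must be `SU(N)`-valued and
the (157) functional is read through `Re`) and (ii) `K0Stub1RealityFromCertificate.herm_of_certificate` (reality of `W`): both need `Dsel♭A′` Hermitian-traceless for
Hermitian-traceless `A′`, which D″'s displayed conjuncts do not yield (LOCATED-REALITY-THREAD, bus 13:44Z).  dag-k0-s1-w4 displayed it at the source (CLAIM-8
`exists_chartDFlat_himp_herm0_T4`), C‴ carried it through the Socket assembly, and THIS FILE is the A6 inhabitant: D″'s proof VERBATIM over C‴, one more name in the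
`obtain`, one more conjunct in the conclusion.

WHAT IS PROVED (sorry-free; no definition; axioms standard).
* ★★★★ `exists_sectF_W_flatScaled_atRecord_herm0` — for every `F : T4Family`, `N ≥ 1`: `∃ Mh₀ R₀ ε C₄`, `0 < ε`, `0 ≤ C₄`, such that at every admissible nested family of
  the record's four-tori in the standing range and its (152) weights there are (as in D″): `τ = ntr` with a dualiser `ρ`, `BE = bondPair η d τ`, `B = Σ_t τ`, the SCALED
  multiplier `M♭` and the ♭ right inverse `H` by their kernel formulas, the IMPLICIT ♭ chart `Dsel` ((55)♭, `ContDiffOn ℂ ω`, (49)♭, (48)♭ on the `ε`-ball) **and its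
  reality «`(∀ b, A′ b ∈ herm0) → (∀ i, Dsel A′ i ∈ herm0) ∧ ∀ b, (A′ − H(Dsel A′)) b ∈ herm0` on the `ε`-ball»**, the transposes `Qt, Ht, Dt A′`, a shift-compatible
  site chart `e` and a map `W` with (157)'s `HasFDerivAt` (print's (80) at instance (S)), `DifferentiableOn ℂ W` on the two-size `ε`-window, and the (158)∕(98) row
  `w₃(b)‖W Y b‖ ≤ C₄·r²`.
HONEST SCOPE.  Non-vacuity ∕ `exact` assembly (C‴ ∘ p589096 ∘ p598821 ∘ dag-k0-s1-w4's scaled-multiplier letters ∘ kernel-defined linear maps), D″'s proof re-run; nothing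
of [15] Sects. D–F or [B7] asserted beyond the engines cited BY NAME; the measure-level identification of the record's constraint with the ♭ functional ((92)∕(97)∕(99)) is
dag-k0-s1-w1's lane and is NOT asserted; `stub_prop8StepCoP13` ∕ `stub_prop8StepCoPG13` ∕ K0⁷ NOT closed; N07 NOT discharged; no summit statement is proved by this seat;
counts unmoved (28∕28 · 5∕27); one finite 𝕋⁴ programme at fixed ε — R4 closes the conditional finite-𝕋⁴ rung `BalabanLadder.UV` only, never the summit; the YM mass gap
(Clay) is NOT proved by any of this; nothing continuum ∕ ℝ⁴ ∕ OS.  No `sorry`, no `def`, no `instance`, no `notation`.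

References: [15] (27) p.282, (44)–(50) p.285, (55) p.286, (72)–(73) p.289, (80) p.290, Prop. 4 (97)–(98) pp.292–293, (152) p.301, (157)–(158) p.302; [B7] Prop. 5 (157)
p.42; [B6] (2.2)–(2.4) p.224, (2.35) p.228, Cor. 2.8 p.249; [Balaban1987RG1] (0.1) p.251, (0.4) p.253.
-/

set_option autoImplicit false

noncomputable section

open scoped BigOperators Matrix.Norms.L2Operator Topology ContDiff

namespace Summit.QuantumFields.YangMills.Theorems.K0Stub1SectFWSlotAtRecordFlatScaledExistsHerm0

open Literature.MathematicalPhysics.QuantumFieldTheory.Balaban1983to89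
open Literature.MathematicalPhysics.QuantumFieldTheory.Balaban1983to89.T4Continuum (T4Family)
open B6SectADomainsV1 (Domains)
open B6SectAOperatorsV1 (BondIdx aE)
open B6SectAVectorModelV1 (EE)
open B9Eq39Adjoint (bondPair)
open B11Eq26ActionExpansion (V0)
open B4Sect5Torus (TSite)
open MatrixNorms (ntr)
open Summit.QuantumFields.YangMills.Theorems.FlatCubeOpsText (Adm22)
open Summit.QuantumFields.YangMills.Theorems.K0FlatCubeOpsTextP (IsLevWeight flatH)
open Summit.QuantumFields.YangMills.Theorems.Prop8ChartDoubleBar (chartLogFlat)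
open Summit.QuantumFields.YangMills.Theorems.K0Stub1PairingsAtExtensions (exists_pairings_transposes_flatOps)
open Summit.QuantumFields.YangMills.Theorems.K0Stub1FibreTraceLetters (exists_fibreLetters)
open B9AdOrthogonal (herm0)
open Summit.QuantumFields.YangMills.Theorems.K0Stub1SectFWSlotAtRecordFlatScaledHerm0 (exists_sectF_W_atRecord_flatScaled_herm0)
open Summit.QuantumFields.YangMills.Theorems.K0Stub1FlatMultiplierScaledO1Letter (h3132_scaledMultiplier_unitWeight_T4 scaledMultiplier_symm)
open Summit.QuantumFields.YangMills.Theorems.K0Stub1MultiplierO1LetterAtRecord (smul_multiplier_symm)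

/-- ★★★★ **D‴ — SECT. F's CURRENT AT INSTANCE (S) EXISTS AT THE RECORD WITH THE (98)-SLOT AND THE REALITY OF THE IMPLICIT ♭ CHART, k-UNIFORMLY, NO LETTER
HYPOTHESIS** (see the module docstring): C‴ `exists_sectF_W_atRecord_flatScaled_herm0` at `Mρ₀ := N³`, `O₁ := O₁♭` with its parameter block inhabited exactly as in D″
(p589096 `exists_fibreLetters`, p598821 `exists_pairings_transposes_flatOps`, `M♭ := LinearMap.pi` of the scaled kernel with dag-k0-s1-w4's `scaledMultiplier_symm` ∕
`h3132_scaledMultiplier_unitWeight_T4`, `H := LinearMap.pi` of the ♭ kernel).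
[cite: Balaban1985Variational, (27) p.282, (44)-(50) p.285, (55) p.286, (72)-(73) p.289, (80) p.290, Prop. 4 (97)-(98) pp.292-293, (152) p.301, (157)-(158) p.302; Balaban1985Averaging, Prop. 5 (157) p.42; Balaban1984PropagatorsII, (2.35) p.228, Cor. 2.8 p.249; Balaban1987RG1, (0.1) p.251, (0.4) p.253] -/
theorem exists_sectF_W_flatScaled_atRecord_herm0 (N : ℕ) [NeZero N] (F : T4Family) :
    ∃ (Mh₀ R₀ : ℕ) (ε C₄ : ℝ), 0 < ε ∧ 0 ≤ C₄ ∧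
    ∀ (n K : ℕ) (_ : 1 ≤ K - n) (_ : K - n + 1 ≤ F.m + K) {Mh R a' : ℕ} (_ : Mh = F.L ^ a') (_ : Mh₀ ≤ Mh) (_ : R₀ ≤ R)
      (_ : a' + 3 ≤ F.m + n) (D : Domains (F.P K)) (_ : D.k = K - n) (_ : Adm22 D R (F.L * Mh))
      {w : ℕ → PBond (F.P K) 0 → ℝ} (_ : IsLevWeight (F.P K) (K - n) D w),
    ∃ (τ : Matrix (Fin N) (Fin N) ℂ →L[ℂ] ℂ) (ρ : (Matrix (Fin N) (Fin N) ℂ →L[ℂ] ℂ) →L[ℂ] Matrix (Fin N) (Fin N) ℂ)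
      (BE : (PBond (F.P K) 0 → Matrix (Fin N) (Fin N) ℂ) →L[ℂ] (PBond (F.P K) 0 → Matrix (Fin N) (Fin N) ℂ) →L[ℂ] ℂ)
      (B : (BondIdx D → Matrix (Fin N) (Fin N) ℂ) →L[ℂ] (BondIdx D → Matrix (Fin N) (Fin N) ℂ) →L[ℂ] ℂ)
      (hc : ((F.P K).L : ℝ) ^ (K - n) ≠ 0) (hwa : ∀ _i : BondIdx D, (0 : ℝ) < 1)
      (MV : (BondIdx D → Matrix (Fin N) (Fin N) ℂ) →L[ℂ] (BondIdx D → Matrix (Fin N) (Fin N) ℂ))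
      (H : (BondIdx D → Matrix (Fin N) (Fin N) ℂ) →ₗ[ℂ] (PBond (F.P K) 0 → Matrix (Fin N) (Fin N) ℂ))
      (Dsel : (PBond (F.P K) 0 → Matrix (Fin N) (Fin N) ℂ) → (BondIdx D → Matrix (Fin N) (Fin N) ℂ))
      (Qt : (BondIdx D → Matrix (Fin N) (Fin N) ℂ) →L[ℂ] (PBond (F.P K) 0 → Matrix (Fin N) (Fin N) ℂ))
      (Ht : (PBond (F.P K) 0 → Matrix (Fin N) (Fin N) ℂ) →L[ℂ] (BondIdx D → Matrix (Fin N) (Fin N) ℂ))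
      (Dt : (PBond (F.P K) 0 → Matrix (Fin N) (Fin N) ℂ) → ((BondIdx D → Matrix (Fin N) (Fin N) ℂ) →L[ℂ] (PBond (F.P K) 0 → Matrix (Fin N) (Fin N) ℂ)))
      (e : Site (F.P K) 0 ≃ TSite (F.P K).d (fun _ => (F.P K).sitesPerDir 0))
      (W : (PBond (F.P K) 0 → Matrix (Fin N) (Fin N) ℂ) → (PBond (F.P K) 0 → Matrix (Fin N) (Fin N) ℂ)),
      -- the objects of record
      (∀ X, τ X = ntr X) ∧ (∀ (ℓ' : Matrix (Fin N) (Fin N) ℂ →L[ℂ] ℂ) (X : Matrix (Fin N) (Fin N) ℂ), τ (ρ ℓ' * X) = ℓ' X) ∧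
      (∀ Y δ : PBond (F.P K) 0 → Matrix (Fin N) (Fin N) ℂ, BE Y δ =
        bondPair ((((F.P K).L : ℝ))⁻¹ ^ (K - n)) (F.P K).d (τ : Matrix (Fin N) (Fin N) ℂ →ₗ[ℂ] ℂ) (fun μ x => Y ⟨x, μ⟩) (fun μ x => δ ⟨x, μ⟩)) ∧
      (∀ X X' : BondIdx D → Matrix (Fin N) (Fin N) ℂ, B X X' = ∑ t, τ (X t * X' t)) ∧
      (∀ (X : BondIdx D → Matrix (Fin N) (Fin N) ℂ) (t : BondIdx D),
        MV X t = ∑ s, (((((F.P K).L : ℝ) ^ (t.1.1 : ℕ) * ((((F.P K).L : ℝ))⁻¹) ^ (K - n))⁻¹ *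
          WithLp.ofLp ((EE D hc hwa - aE D (fun _ => (1 : ℝ))) (WithLp.toLp 2 (Pi.single s 1))) t *
          (((F.P K).L : ℝ) ^ (s.1.1 : ℕ) * ((((F.P K).L : ℝ))⁻¹) ^ (K - n))⁻¹ : ℝ) : ℂ) • X s) ∧
      (∀ (X : BondIdx D → Matrix (Fin N) (Fin N) ℂ) (b : PBond (F.P K) 0), H X b =
        ∑ t, (((((F.P K).L : ℝ) ^ (t.1.1 : ℕ) * ((((F.P K).L : ℝ))⁻¹) ^ (K - n))⁻¹ * flatH (F.P K) (K - n) D (Pi.single t 1) b : ℝ) : ℂ) • X t) ∧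
      -- the implicit ♭ chart on the `ε`-ball: (55)♭, analyticity, (49)♭, (48)♭
      (∀ A' : PBond (F.P K) 0 → Matrix (Fin N) (Fin N) ℂ, (∀ b, w 1 b * ‖A' b‖ < ε) →
        ∀ ρ' : ℝ, 0 ≤ ρ' → (∀ b, w 1 b * ‖A' b‖ ≤ ρ') → ∀ i : BondIdx D, ‖Dsel A' i‖ ≤ C₄ * ρ' ^ 2) ∧
      ContDiffOn ℂ ω Dsel {Y : PBond (F.P K) 0 → Matrix (Fin N) (Fin N) ℂ | ∀ b, w 1 b * ‖Y b‖ < ε} ∧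
      (∀ A' : PBond (F.P K) 0 → Matrix (Fin N) (Fin N) ℂ, (∀ b, w 1 b * ‖A' b‖ < ε) →
        chartLogFlat (((((F.P K).L : ℝ))⁻¹) ^ (K - n)) D (A' - H (Dsel A')) - (fderiv ℂ (chartLogFlat (((((F.P K).L : ℝ))⁻¹) ^ (K - n)) D :
        (PBond (F.P K) 0 → Matrix (Fin N) (Fin N) ℂ) → BondIdx D → Matrix (Fin N) (Fin N) ℂ) 0) (A' - H (Dsel A')) = Dsel A' ∧
        chartLogFlat (((((F.P K).L : ℝ))⁻¹) ^ (K - n)) D (A' - H (Dsel A')) = (fderiv ℂ (chartLogFlat (((((F.P K).L : ℝ))⁻¹) ^ (K - n)) D :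
        (PBond (F.P K) 0 → Matrix (Fin N) (Fin N) ℂ) → BondIdx D → Matrix (Fin N) (Fin N) ℂ) 0) A') ∧
      -- the reality of the implicit ♭ chart on Hermitian-traceless fields (dag-k0-s1-w4 CLAIM-8, threaded through C‴)
      (∀ A' : PBond (F.P K) 0 → Matrix (Fin N) (Fin N) ℂ, (∀ b, w 1 b * ‖A' b‖ < ε) → (∀ b, A' b ∈ herm0 (Fin N)) →
        (∀ i, Dsel A' i ∈ herm0 (Fin N)) ∧ ∀ b, (A' - H (Dsel A')) b ∈ herm0 (Fin N)) ∧
      -- the transposes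
      (∀ X δ, BE (Qt X) δ = B X ((fderiv ℂ (chartLogFlat (((((F.P K).L : ℝ))⁻¹) ^ (K - n)) D :
        (PBond (F.P K) 0 → Matrix (Fin N) (Fin N) ℂ) → BondIdx D → Matrix (Fin N) (Fin N) ℂ) 0) δ)) ∧
      (∀ Z X, BE Z (H X) = B (Ht Z) X) ∧
      (∀ (A' : PBond (F.P K) 0 → Matrix (Fin N) (Fin N) ℂ) X δ, BE (Dt A' X) δ = B X (fderiv ℂ Dsel A' δ)) ∧
      -- the chart, (157), the window, the (158)∕(98) row
      (∀ (x : Site (F.P K) 0) (μ : Fin (F.P K).d), e (x.shift μ) = B9SectCLatticeCarrier.shift μ (e x)) ∧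
      (∀ A' : PBond (F.P K) 0 → Matrix (Fin N) (Fin N) ℂ, (∀ b, w 1 b * ‖A' b‖ < ε) →
        (∀ (b : PBond (F.P K) 0) (ν : Fin (F.P K).d), w 2 b * ((F.P K).L : ℝ) ^ (K - n) * ‖A' ⟨b.src.shift ν, b.dir⟩ - A' b‖ < ε) →
        HasFDerivAt (fun A : PBond (F.P K) 0 → Matrix (Fin N) (Fin N) ℂ => 2⁻¹ * B (Dsel A) (((((((((F.P K).L : ℝ))⁻¹) ^ (K - n) : ℝ) : ℂ) ^ (F.P K).d) • MV) (Dsel A))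
            - B ((fderiv ℂ (chartLogFlat (((((F.P K).L : ℝ))⁻¹) ^ (K - n)) D :
        (PBond (F.P K) 0 → Matrix (Fin N) (Fin N) ℂ) → BondIdx D → Matrix (Fin N) (Fin N) ℂ) 0) A)
                (((((((((F.P K).L : ℝ))⁻¹) ^ (K - n) : ℝ) : ℂ) ^ (F.P K).d) • MV) (Dsel A))
            + V0 (LatticeFieldCalculus.shiftEquiv (P := F.P K) (j := 0)) (fun _ _ => (1 : (Matrix (Fin N) (Fin N) ℂ)ˣ)) ((((F.P K).L : ℝ)⁻¹) ^ (K - n)) (F.P K).d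
                (τ : Matrix (Fin N) (Fin N) ℂ →ₗ[ℂ] ℂ) (fun μ x => (A - H (Dsel A)) ⟨x, μ⟩))
          (BE (W A')) A') ∧
      DifferentiableOn ℂ W {Y : PBond (F.P K) 0 → Matrix (Fin N) (Fin N) ℂ | (∀ b, w 1 b * ‖Y b‖ < ε) ∧
        ∀ (b : PBond (F.P K) 0) (ν : Fin (F.P K).d), w 2 b * ((F.P K).L : ℝ) ^ (K - n) * ‖Y ⟨b.src.shift ν, b.dir⟩ - Y b‖ < ε} ∧
      (∀ (Y : PBond (F.P K) 0 → Matrix (Fin N) (Fin N) ℂ) (r : ℝ), r < ε → (∀ b, w 1 b * ‖Y b‖ ≤ r) →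
        (∀ (b : PBond (F.P K) 0) (ν : Fin (F.P K).d), w 2 b * ((F.P K).L : ℝ) ^ (K - n) * ‖Y ⟨b.src.shift ν, b.dir⟩ - Y b‖ ≤ r) →
        ∀ b, w 3 b * ‖W Y b‖ ≤ C₄ * r ^ 2) := by
  obtain ⟨Mh₄, R₄, O₁, hO₁, h3132⟩ := h3132_scaledMultiplier_unitWeight_T4 F
  obtain ⟨Mh₀, R₀, h₀, ε, CD, Θ₀, hh₀, hε, hCD, hΘ₀, hmain⟩ :=
    exists_sectF_W_atRecord_flatScaled_herm0 N F ((N : ℝ) ^ 3) O₁ (by positivity) hO₁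
  -- the slot constant at `M_ρ = N³`, `d = 4`, `L = F.L` (also dominating the (55)♭ constant `C_D`)
  refine ⟨max Mh₀ Mh₄, max R₀ R₄, ε,
    max CD ((Θ₀ * (N : ℝ) ^ 3) * O₁ * (CD * ε + (F.L : ℝ)) + 2 * O₁ * CD
      + (1 + (Θ₀ * (N : ℝ) ^ 3) * ε * h₀) * ((((4 : ℕ) - 1 : ℕ) : ℝ) * (((F.L : ℝ)) ^ 2) ^ 3 * (N : ℝ) ^ 3 * (200 + 2 * (F.L : ℝ) ^ 2)) * (2 : ℝ) ^ 2),
    hε, le_max_of_le_left hCD, ?_⟩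
  intro n K hk1 hk' Mh R a' hMha hMh hR hsize D hDk hAdm w hw
  have hMh₀ : Mh₀ ≤ Mh := le_trans (le_max_left _ _) hMh
  have hMh₄ : Mh₄ ≤ Mh := le_trans (le_max_right _ _) hMh
  have hR₀ : R₀ ≤ R := le_trans (le_max_left _ _) hR
  have hR₄ : R₄ ≤ R := le_trans (le_max_right _ _) hR
  have hL0 : (0 : ℝ) < ((F.P K).L : ℝ) := by exact_mod_cast (F.P K).L_pos
  haveI : Fact ((0 : ℝ) < ((F.P K).L : ℝ)) := ⟨hL0⟩
  haveI : Fact ((0 : ℝ) < (((F.P K).L : ℝ))⁻¹ ^ (K - n)) := ⟨by positivity⟩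
  have hc : ((F.P K).L : ℝ) ^ (K - n) ≠ 0 := by positivity
  have hη : ((((F.P K).L : ℝ))⁻¹ ^ (K - n)) ≠ 0 := by positivity
  -- the fibre letters of record (p589096): `τ = ntr`, dualiser `ρ`, `M_ρ = N³`
  obtain ⟨τ, ρ, hntr, hτ, hτs, hτ1, -, hρ, hρn⟩ := exists_fibreLetters N
  -- p598821's pairings and multiplier (`c = L^{K−n}`, unit block weight)
  obtain ⟨BE, B, -, -, MV, -, -, hBE, hB, -, -, hMV, -, -, hBsymm, hMsym, -, -⟩ :=
    exists_pairings_transposes_flatOps D hc (w := fun _ : BondIdx D => (1 : ℝ)) (fun _ => one_pos)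
      (𝔸 := Matrix (Fin N) (Fin N) ℂ) hη (τ : Matrix (Fin N) (Fin N) ℂ →ₗ[ℂ] ℂ) hτ
  -- the multiplier's kernel formula at an ARBITRARY `DecidableEq (BondIdx D)` instance of `Pi.single` (instances form a subsingleton; p598821 states it at its own)
  have hMVgen : ∀ (d : DecidableEq (BondIdx D)) (X : BondIdx D → Matrix (Fin N) (Fin N) ℂ) (t : BondIdx D),
      MV X t = ∑ s, ((WithLp.ofLp ((EE D hc (fun _ => one_pos) - aE D fun _ => (1 : ℝ))
        (WithLp.toLp 2 (@Pi.single (BondIdx D) (fun _ => ℝ) _ d s 1))) t : ℝ) : ℂ) • X s := by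
    intro d X t
    rw [hMV X t]
    exact Finset.sum_congr rfl fun s _ =>
      congrArg (fun v : BondIdx D → ℝ => ((WithLp.ofLp ((EE D hc (fun _ => one_pos) - aE D fun _ => (1 : ℝ)) (WithLp.toLp 2 v)) t : ℝ) : ℂ) • X s)
        (congrArg (fun inst : DecidableEq (BondIdx D) => @Pi.single (BondIdx D) (fun _ => ℝ) _ inst s (1 : ℝ)) (Subsingleton.elim _ _))
  -- the SCALED multiplier `M♭` (instance (S)): kernel `λ_t⁻¹·m(t,s)·λ_s⁻¹`, defined by `LinearMap.pi`; `B`-symmetric by k0-s1-w4's `scaledMultiplier_symm`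
  let mker : BondIdx D → BondIdx D → ℝ := fun t s =>
    WithLp.ofLp ((EE D hc (fun _ => one_pos) - aE D fun _ => (1 : ℝ)) (WithLp.toLp 2 (Pi.single s 1))) t
  let lam : BondIdx D → ℝ := fun t => (((F.P K).L : ℝ) ^ (t.1.1 : ℕ) * ((((F.P K).L : ℝ))⁻¹) ^ (K - n))⁻¹
  let Mf : (BondIdx D → Matrix (Fin N) (Fin N) ℂ) →L[ℂ] (BondIdx D → Matrix (Fin N) (Fin N) ℂ) :=
    LinearMap.toContinuousLinearMap (LinearMap.pi fun t => ∑ s, ((lam t * mker t s * lam s : ℝ) : ℂ) • LinearMap.proj s)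
  have hMfgen : ∀ (d : DecidableEq (BondIdx D)) (X : BondIdx D → Matrix (Fin N) (Fin N) ℂ) (t : BondIdx D),
      Mf X t = ∑ s, (((((F.P K).L : ℝ) ^ (t.1.1 : ℕ) * ((((F.P K).L : ℝ))⁻¹) ^ (K - n))⁻¹ *
        WithLp.ofLp ((EE D hc (fun _ => one_pos) - aE D fun _ => (1 : ℝ)) (WithLp.toLp 2 (@Pi.single (BondIdx D) (fun _ => ℝ) _ d s 1))) t *
        (((F.P K).L : ℝ) ^ (s.1.1 : ℕ) * ((((F.P K).L : ℝ))⁻¹) ^ (K - n))⁻¹ : ℝ) : ℂ) • X s := by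
    intro d X t
    simp only [Mf, mker, lam, LinearMap.coe_toContinuousLinearMap', LinearMap.pi_apply, LinearMap.coe_sum, Finset.sum_apply, LinearMap.smul_apply,
      LinearMap.coe_proj, Function.eval]
    exact Finset.sum_congr rfl fun s _ =>
      congrArg (fun v : BondIdx D → ℝ => (((((F.P K).L : ℝ) ^ (t.1.1 : ℕ) * ((((F.P K).L : ℝ))⁻¹) ^ (K - n))⁻¹ *
        WithLp.ofLp ((EE D hc (fun _ => one_pos) - aE D fun _ => (1 : ℝ)) (WithLp.toLp 2 v)) t * (((F.P K).L : ℝ) ^ (s.1.1 : ℕ) * ((((F.P K).L : ℝ))⁻¹) ^ (K - n))⁻¹ : ℝ) : ℂ) • X s)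
        (congrArg (fun inst : DecidableEq (BondIdx D) => @Pi.single (BondIdx D) (fun _ => ℝ) _ inst s (1 : ℝ)) (Subsingleton.elim _ _))
  have hMfsym : ∀ a b, B (Mf a) b = B a (Mf b) :=
    scaledMultiplier_symm τ B hB mker MV (hMVgen _) hMsym lam Mf (hMfgen _)
  have hMsym' : ∀ a b, B (((((((((F.P K).L : ℝ))⁻¹) ^ (K - n) : ℝ) : ℂ) ^ (F.P K).d) • Mf) a) b = B a (((((((((F.P K).L : ℝ))⁻¹) ^ (K - n) : ℝ) : ℂ) ^ (F.P K).d) • Mf) b) := smul_multiplier_symm B Mf hMfsym _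
  have h3132' : ∀ (X : BondIdx D → Matrix (Fin N) (Fin N) ℂ) (s : ℝ), (∀ i, (1 : ℝ) * ‖X i‖ ≤ s) →
      ∀ i, (1 : ℝ) * ‖((((((((F.P K).L : ℝ))⁻¹) ^ (K - n) : ℝ) : ℂ) ^ (F.P K).d) • Mf) X i‖ ≤ O₁ * s :=
    fun X s hX i => h3132 n K hk1 hk' hMha hMh₄ hR₄ hsize D hDk hAdm hc (w := fun _ : BondIdx D => (1 : ℝ)) (fun _ => one_pos) Mf (hMfgen _) X s hX i
  -- the ♭ right inverse, defined by its kernel (again at an arbitrary instance)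
  let coef : BondIdx D → PBond (F.P K) 0 → ℝ := fun t b =>
    (((F.P K).L : ℝ) ^ (t.1.1 : ℕ) * ((((F.P K).L : ℝ))⁻¹) ^ (K - n))⁻¹ * flatH (F.P K) (K - n) D (Pi.single t 1) b
  let H : (BondIdx D → Matrix (Fin N) (Fin N) ℂ) →ₗ[ℂ] (PBond (F.P K) 0 → Matrix (Fin N) (Fin N) ℂ) :=
    LinearMap.pi fun b => ∑ t, ((coef t b : ℝ) : ℂ) • LinearMap.proj t
  have hHgen : ∀ (d : DecidableEq (BondIdx D)) (X : BondIdx D → Matrix (Fin N) (Fin N) ℂ) (b : PBond (F.P K) 0), H X b =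
      ∑ t, (((((F.P K).L : ℝ) ^ (t.1.1 : ℕ) * ((((F.P K).L : ℝ))⁻¹) ^ (K - n))⁻¹ *
        flatH (F.P K) (K - n) D (@Pi.single (BondIdx D) (fun _ => ℝ) _ d t 1) b : ℝ) : ℂ) • X t := by
    intro d X b
    simp only [H, coef, LinearMap.pi_apply, LinearMap.coe_sum, Finset.sum_apply, LinearMap.smul_apply, LinearMap.coe_proj, Function.eval]
    exact Finset.sum_congr rfl fun t _ =>
      congrArg (fun v : BondIdx D → ℝ => (((((F.P K).L : ℝ) ^ (t.1.1 : ℕ) * ((((F.P K).L : ℝ))⁻¹) ^ (K - n))⁻¹ * flatH (F.P K) (K - n) D v b : ℝ) : ℂ) • X t)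
        (congrArg (fun inst : DecidableEq (BondIdx D) => @Pi.single (BondIdx D) (fun _ => ℝ) _ inst t (1 : ℝ)) (Subsingleton.elim _ _))
  obtain ⟨Dsel, h55, hcd, hfix, hherm, Qt, Ht, Dt, hQt, hHt, hDt, e, W, he, h157, hdiff, h158⟩ :=
    hmain n K hk1 hk' hMha hMh₀ hR₀ hsize D hDk hAdm hw H (hHgen _) τ ρ hρ hτ hτs hτ1 (Mρ := (N : ℝ) ^ 3) (by positivity) le_rfl hρn
      BE hBE B hB hBsymm ((((((((F.P K).L : ℝ))⁻¹) ^ (K - n) : ℝ) : ℂ) ^ (F.P K).d) • Mf) hMsym' h3132'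
  refine ⟨τ, ρ, BE, B, hc, fun _ => one_pos, Mf, H, Dsel, Qt, Ht, Dt, e, W, hntr, hρ, hBE, hB, hMfgen _, hHgen _, ?_, hcd, hfix, hherm, hQt, hHt, hDt, he, h157, hdiff, ?_⟩
  · -- (55)♭ with the dominating constant
    intro A' hA' ρ' hρ' hle i
    exact (h55 A' hA' ρ' hρ' hle i).trans (mul_le_mul_of_nonneg_right (le_max_left _ _) (by positivity))
  · -- the (158)∕(98) row with the dominating constant
    intro Y r hr h1 h2 b
    exact (h158 Y r hr h1 h2 b).trans (mul_le_mul_of_nonneg_right (le_max_right _ _) (by positivity))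

end Summit.QuantumFields.YangMills.Theorems.K0Stub1SectFWSlotAtRecordFlatScaledExistsHerm0

end
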